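import Summits.Ventures.PercRepro.C025Profile

/-!
# PercRepro — the profile inequality at the TOP LEVEL `u = ρ(E)` (p10, gen 0; S5 §2.2(iv))

`proofs/NIGHT3-G6-PROFILE.md` §7(c) / `proofs/SUBCLAIM-S5-p10.md` §2.2(iv): at the top level `u = R := ρ(E)` the
profile price of a rank-`q` set `B` with `ρ(E ∖ B) ≥ R` (i.e. `= R`) is `C(R+q, R)/C(R+q, q) = 1`, and `B ↦ E ∖ B`
injects these sets into the spanning sets, so `(Π_{q,R})` holds for every finite matroid and every `q < R`.

* `price_top` — the price at the top level is `1` above the threshold;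
* `sdiff_mem_levelSet_top` — the complement of a set with `ρ(E ∖ B) = R` is a spanning set;
* **`profileIneq_top`** — `Profile.ProfileIneq M q R` for every `q` and `R = ρ(E)`.
-/

namespace PercRepro.Profile

open Finset ThmH Shadow

variable {α : Type*} [DecidableEq α] {M : Matroid α} [M.Finite]

/-- Above the threshold, the price at the top level `u = R = ρ(E)` is `1`. -/
theorem price_top {R : ℕ} (hR : M.eRank = (R : ℕ∞)) (q : ℕ) {B : Finset α}
    (h : (R : ℕ∞) ≤ M.eRk ((gr M \ B : Finset α) : Set α)) : price M q R B = 1 := by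
  have hle : M.eRk ((gr M \ B : Finset α) : Set α) ≤ (R : ℕ∞) := by
    rw [← hR]; exact M.eRk_le_eRank _
  have heq : M.eRk ((gr M \ B : Finset α) : Set α) = (R : ℕ∞) := le_antisymm hle h
  unfold price
  rw [if_pos h, heq, ENat.toNat_coe, Nat.choose_symm_add, div_self]
  exact_mod_cast (Nat.choose_pos (Nat.le_add_left _ _)).ne'

/-- The complement of a set whose complement has full rank is a spanning set (a rank-`R` set). -/
theorem sdiff_mem_levelSet_top {R : ℕ} (hR : M.eRank = (R : ℕ∞)) {B : Finset α}
    (h : (R : ℕ∞) ≤ M.eRk ((gr M \ B : Finset α) : Set α)) : gr M \ B ∈ levelSet M R := by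
  rw [mem_levelSet]
  refine ⟨Finset.sdiff_subset, le_antisymm ?_ h⟩
  rw [← hR]; exact M.eRk_le_eRank _

/-- **`(Π_{q,R})` at the top level** for every finite matroid, every `q` and `R = ρ(E)`: the sets of rank `q` whose
complement spans are at most as many as the spanning sets (`B ↦ E ∖ B`), and each costs exactly `1`. -/
theorem profileIneq_top {R : ℕ} (hR : M.eRank = (R : ℕ∞)) (q : ℕ) : ProfileIneq M q R := by
  classical
  unfold ProfileIneq
  -- the summands are `1` on the sets above the threshold and `0` elsewhere
  set T : Finset (Finset α) :=
    (Rq M q).filter (fun B => (R : ℕ∞) ≤ M.eRk ((gr M \ B : Finset α) : Set α)) with hT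
  have hsum : ∑ B ∈ Rq M q, price M q R B = (T.card : ℚ) := by
    rw [← Finset.sum_filter_add_sum_filter_not (Rq M q)
      (fun B => (R : ℕ∞) ≤ M.eRk ((gr M \ B : Finset α) : Set α))]
    rw [Finset.sum_congr rfl (fun B hB => price_top hR q (Finset.mem_filter.1 hB).2), Finset.sum_const,
      nsmul_eq_mul, mul_one]
    have hzero : ∑ B ∈ (Rq M q).filter (fun B => ¬ (R : ℕ∞) ≤ M.eRk ((gr M \ B : Finset α) : Set α)),
        price M q R B = 0 := by
      apply Finset.sum_eq_zero
      intro B hB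
      unfold price
      rw [if_neg (Finset.mem_filter.1 hB).2]
    rw [hzero, add_zero]
  rw [hsum]
  have hinj : T.card ≤ (levelSet M R).card := by
    apply Finset.card_le_card_of_injOn (fun B => gr M \ B)
    · intro B hB
      rw [Finset.mem_coe]
      exact sdiff_mem_levelSet_top hR (Finset.mem_filter.1 hB).2
    · intro B hB B' hB' hBB'
      have hBg : B ⊆ gr M := (mem_Rq.1 (Finset.mem_filter.1 hB).1).1
      have hB'g : B' ⊆ gr M := (mem_Rq.1 (Finset.mem_filter.1 hB').1).1
      have h1 : gr M \ (gr M \ B) = B := Finset.sdiff_sdiff_eq_self hBg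
      have h2 : gr M \ (gr M \ B') = B' := Finset.sdiff_sdiff_eq_self hB'g
      rw [← h1, ← h2]
      simp only at hBB'
      rw [hBB']
  exact_mod_cast hinj

end PercRepro.Profile
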